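import Mathlib
import Summits.MatrixMultiplication.MatrixMultiplication.Theorems.SoloBlindConjEReduction
import Summits.MatrixMultiplication.MatrixMultiplication.Theorems.SoloBlindTypeCoords

/-!
# Presence of a representation over an independent block, in coordinates

Fourth plumbing lemma of the kernel plan for the type model (solo-blind programme, K3.35),
connecting the coordinate dictionary (`SoloBlindTypeCoords`) with the programme's objects
`soloBlindSeqRepAll` / `soloBlindMass`: with `β = Basis.sumExtend hli` extending the
`ZMod 3`-independent block `(h i)_{i ∈ B}`,
* `g` has a representation `A ⊆ B`, `∑_{i∈A} h i = g` iff the ambient coordinates of `g` vanish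
  and its block coordinates are `0/1` ("`C` is present iff every residue is `0` or `1`");
* a representation `A` consists exactly of the block indices whose coordinate is `1`
  ("`A_C` = coordinates of type `1`").
Nothing here bears on `ω`.
-/

namespace Summit.MatrixMultiplication.MatrixMultiplication.Theorems

open Finset Module

variable {G : Type*} [AddCommGroup G] [DecidableEq G] [Module (ZMod 3) G] {ι : Type*} [DecidableEq ι]

omit [DecidableEq G] [Module (ZMod 3) G] in
/-- Re-indexing a subset of `B` as a finset of the subtype `↥B` preserves the block sum. -/
theorem soloBlind_sum_subtype_of_subset (h : ι → G) {B A : Finset ι} (hAB : A ⊆ B) :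
    ∑ j ∈ A.subtype (· ∈ B), h (j : ι) = ∑ i ∈ A, h i := by
  rw [Finset.sum_subtype_eq_sum_filter]
  rw [Finset.filter_true_of_mem (fun i hi => hAB hi)]

omit [DecidableEq G] [Module (ZMod 3) G] [DecidableEq ι] in
/-- Re-indexing a finset of the subtype `↥B` as a subset of `B` preserves the block sum. -/
theorem soloBlind_sum_map_subtype (h : ι → G) {B : Finset ι} (A : Finset B) :
    ∑ i ∈ A.map (Function.Embedding.subtype _), h i = ∑ j ∈ A, h (j : ι) := by
  rw [Finset.sum_map]
  rfl

/-- PRESENCE IN COORDINATES. `g` is represented over the block iff its ambient coordinates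
vanish and its block coordinates are `0` or `1`. -/
theorem soloBlind_repAll_nonempty_iff_coords (h : ι → G) (B : Finset ι)
    (hli : LinearIndependent (ZMod 3) (fun i : B => h i)) (g : G) :
    (soloBlindSeqRepAll h B g).Nonempty ↔
      (∀ j : Basis.sumExtendIndex hli, (Basis.sumExtend hli).coord (Sum.inr j) g = 0) ∧
      (∀ i : B, (Basis.sumExtend hli).coord (Sum.inl i) g = 0 ∨
        (Basis.sumExtend hli).coord (Sum.inl i) g = 1) := by
  rw [← soloBlind_subsetSum_iff_coords h B hli g]
  constructor
  · rintro ⟨A, hA⟩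
    rw [soloBlind_mem_seqRepAll] at hA
    obtain ⟨hAB, hsum⟩ := hA
    exact ⟨A.subtype (· ∈ B), by rw [soloBlind_sum_subtype_of_subset h hAB, hsum]⟩
  · rintro ⟨A, hA⟩
    refine ⟨A.map (Function.Embedding.subtype _), ?_⟩
    rw [soloBlind_mem_seqRepAll]
    refine ⟨?_, by rw [soloBlind_sum_map_subtype, hA]⟩
    intro i hi
    rw [Finset.mem_map] at hi
    obtain ⟨j, -, rfl⟩ := hi
    exact j.2

/-- THE REPRESENTATION IN COORDINATES. A representation `A` of `g` over the block consists
exactly of the block indices whose coordinate equals `1`. -/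
theorem soloBlind_mem_repAll_iff_coord_eq_one (h : ι → G) (B : Finset ι)
    (hli : LinearIndependent (ZMod 3) (fun i : B => h i)) {g : G} {A : Finset ι}
    (hA : A ∈ soloBlindSeqRepAll h B g) (i : B) :
    (i : ι) ∈ A ↔ (Basis.sumExtend hli).coord (Sum.inl i) g = 1 := by
  rw [soloBlind_mem_seqRepAll] at hA
  obtain ⟨hAB, hsum⟩ := hA
  rw [← hsum, ← soloBlind_sum_subtype_of_subset h hAB, soloBlind_coord_inl_subsetSum]
  by_cases hiA : (i : ι) ∈ A
  · have hmem : i ∈ A.subtype (· ∈ B) := Finset.mem_subtype.mpr hiA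
    simp [hmem, hiA]
  · have hmem : i ∉ A.subtype (· ∈ B) := fun hh => hiA (Finset.mem_subtype.mp hh)
    simp [hmem, hiA]

/-- Consequently a representation is the block filter "coordinate `= 1`"; in particular it is
unique and its cardinality is the number of block coordinates equal to `1`. -/
theorem soloBlind_repAll_eq_filter (h : ι → G) (B : Finset ι)
    (hli : LinearIndependent (ZMod 3) (fun i : B => h i)) {g : G} {A : Finset ι}
    (hA : A ∈ soloBlindSeqRepAll h B g) :
    A = (Finset.univ.filter fun i : B =>
      (Basis.sumExtend hli).coord (Sum.inl i) g = 1).map (Function.Embedding.subtype _) := by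
  have hAB : A ⊆ B := ((soloBlind_mem_seqRepAll).mp hA).1
  ext i
  constructor
  · intro hi
    rw [Finset.mem_map]
    refine ⟨⟨i, hAB hi⟩, ?_, rfl⟩
    rw [Finset.mem_filter]
    exact ⟨Finset.mem_univ _, (soloBlind_mem_repAll_iff_coord_eq_one h B hli hA ⟨i, hAB hi⟩).mp hi⟩
  · intro hi
    rw [Finset.mem_map] at hi
    obtain ⟨j, hj, rfl⟩ := hi
    rw [Finset.mem_filter] at hj
    exact (soloBlind_mem_repAll_iff_coord_eq_one h B hli hA j).mpr hj.2

/-- Cardinality of a representation = number of block coordinates equal to `1`. -/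
theorem soloBlind_repAll_card_eq (h : ι → G) (B : Finset ι)
    (hli : LinearIndependent (ZMod 3) (fun i : B => h i)) {g : G} {A : Finset ι}
    (hA : A ∈ soloBlindSeqRepAll h B g) :
    A.card = (Finset.univ.filter fun i : B =>
      (Basis.sumExtend hli).coord (Sum.inl i) g = 1).card := by
  rw [soloBlind_repAll_eq_filter h B hli hA, Finset.card_map]

end Summit.MatrixMultiplication.MatrixMultiplication.Theorems
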